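import Mathlib
import Summits.ResolutionOfSingularities.ResolutionOfSingularities.Theorems.SyzygyFlatteningRankOneTerminationSurfaceDatum
import HarnessLib

/-!
# The surface step, II: at a singular stage of a surface the syzygy-flattening step is Zariski's
# normalised quadratic transform (crux stmt-ResolutionOfSingularities-17044, line `birth`)

Crux `RankOneTermination` (route `SyzygyFlattening`).  This file proves the registered stub
`stub_surfaceStep`: for `tr.deg_k K = 2`, at a SINGULAR stage `T_{m+1}` the next stage is
Zariski's normalised quadratic transform along the valuation,
`T_{m+2} = locAt O (nrm (T_{m+1}[𝔪/x]))`, `x ∈ 𝔪` of maximal valuation — the `n = 2` case of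
the lead's theorem "at an isolated singular stage the norm blow-up of `Ωⁿ(κ)` is the blow-up of
the closed point, up to normalisation" (Cruxes/RankOneTermination/NOTES.md).  It turns the
`n = 2` case of the crux into Lipman's theorem (the tower from `T₁` on IS the sequence "blow up
the singular point, normalise" followed along `v`).

* `step_eq_quadraticTransform` — `step O B = locAt O (nrm (B[𝔪/x]))` for an abstract isolated
  singular stage of embedding dimension `≥ 3` (datum `surfaceStep_datum` of part I on a
  resolution extending the minimal presentation, `stub_extendResolution`; canonical form
  `locAt_step_eq`; the ratios lie in `B[𝔪/x]`, which is integral over `B[ratios]`);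
* `singIdeal_eq_maximalIdeal_of_isolated`, `exists_spanFinrank_eq_add_three` — a singular
  isolated stage has `singIdeal = 𝔪`; a singular normal local domain has `edim ≥ 3`;
* `stub_surfaceStep` — the tower form.
-/

noncomputable section

-- single-problem summit: the doubled namespace component `ResolutionOfSingularities` is forced
set_option linter.dupNamespace false

namespace Summit.ResolutionOfSingularities.ResolutionOfSingularities.Theorems.SyzygyFlattening

open IsLocalRing
open Literature.AlgebraicGeometry.Resolution (isFractionRing_subalgebra_of_le
  isIntegral_of_mem_subalgebra)

variable {k K : Type} [Field k] [Field K] [Algebra k K]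

/-! ## The step at a singular surface stage is the normalised quadratic transform -/

/-- **The surface step for an abstract stage.**  Let `B ⊆ O` be a Noetherian local stage, closed
under `locAt O`, with `Frac B = K` of transcendence degree `2`, isolated and singular
(`singIdeal B = 𝔪`) and of embedding dimension `≥ 3`.  Then for the generator `x = xg 0` of `𝔪`
of maximal valuation, `step O B = locAt O (nrm (B[𝔪/x]))`.  Proof: the datum of
`surfaceStep_datum` on a resolution extending the minimal presentation
(`stub_extendResolution`) is a qualifying datum of the crux, so by the canonical form
`locAt_step_eq` the step is `locAt O (nrm (B[ratios]))`; the ratios lie in `B[𝔪/x]`, and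
`B[𝔪/x]` is integral over `B[ratios]` (`(xg (i+1)/x)^{e+1}` is a ratio), so the two
normalisations agree. [folklore] -/
theorem step_eq_quadraticTransform (O : ValuationSubring K) (B : Subalgebra k K) [IsLocalRing ↥B]
    [IsNoetherianRing ↥B] (hk : ∀ c : k, algebraMap k K c ∈ O) (hB : B.toSubring ≤ O.toSubring)
    (hFrac : IsFractionRing ↥B K) (hloc : locAt O B = B)
    (hJ : singIdeal B = maximalIdeal ↥B) (hn : syzygyIndex k K = 2) {e : ℕ}
    (he : (maximalIdeal ↥B).spanFinrank = e + 3) :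
    ∃ x : K, x ∈ B ∧ O.valuation x < 1 ∧
      (∀ y ∈ B, O.valuation y < 1 → O.valuation y ≤ O.valuation x) ∧
      step O B = locAt O (nrm (Algebra.adjoin k ((B : Set K) ∪
        {y : K | ∃ a ∈ B, O.valuation a < 1 ∧ y = a * x⁻¹}))) := by
  classical
  haveI : IsFractionRing ↥B K := hFrac
  obtain ⟨xg, hspan, hminrel, hval⟩ := stub_minGenerators k K O B (e + 2) he
  have hx0mem : xg 0 ∈ maximalIdeal ↥B := hspan ▸ Ideal.subset_span ⟨0, rfl⟩
  have hvx0 : O.valuation ((xg 0 : ↥B) : K) < 1 :=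
    (mem_maximalIdeal_iff_valuation_lt_one O B hB hloc _).mp hx0mem
  have hx0ne : xg 0 ≠ 0 := by
    intro h0
    have hrel : ∑ i, (if i = 0 then (1 : ↥B) else 0) * xg i = 0 := by
      simp [h0]
    have := hminrel _ hrel 0
    simp only [if_true] at this
    exact (maximalIdeal.isMaximal ↥B).ne_top ((Ideal.eq_top_iff_one _).mpr this)
  have hx0K : ((xg 0 : ↥B) : K) ≠ 0 := fun h => hx0ne (by exact_mod_cast h)
  -- the minimal presentation `B^{e+3} —xg→ B¹ —→ B ⧸ J`
  set φ : (Fin (e + 3) → ↥B) →ₗ[↥B] (Fin 1 → ↥B) :=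
    LinearMap.pi fun _ : Fin 1 => Fintype.linearCombination ↥B xg with hφ
  let ε₀ : (Fin 1 → ↥B) →ₗ[↥B] (↥B ⧸ singIdeal B) := (singIdeal B).mkQ ∘ₗ LinearMap.proj 0
  have hε₀ : Function.Surjective ε₀ := by
    intro q
    obtain ⟨b', rfl⟩ := Submodule.Quotient.mk_surjective _ q
    exact ⟨fun _ => b', rfl⟩
  have hex : Function.Exact φ ε₀ := by
    intro w
    constructor
    · intro hw
      have hw0 : w 0 ∈ maximalIdeal ↥B := by
        rw [← hJ]
        exact (Submodule.Quotient.mk_eq_zero _).mp hw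
      rw [← hspan, Ideal.mem_span_range_iff_exists_fun] at hw0
      obtain ⟨c, hc⟩ := hw0
      refine ⟨c, funext fun j => ?_⟩
      rw [Subsingleton.elim j 0]
      simp only [hφ, LinearMap.pi_apply, Fintype.linearCombination_apply, smul_eq_mul]
      exact hc
    · rintro ⟨c, rfl⟩
      change (singIdeal B).mkQ (φ c 0) = 0
      rw [Submodule.mkQ_apply, Submodule.Quotient.mk_eq_zero, hJ, ← hspan]
      simp only [hφ, LinearMap.pi_apply, Fintype.linearCombination_apply, smul_eq_mul]
      exact Ideal.sum_mem _ fun i _ => Ideal.mul_mem_left _ _ (Ideal.subset_span ⟨i, rfl⟩)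
  obtain ⟨b, d, ε, hε, h0, hs, ⟨θ⟩⟩ :=
    stub_extendResolution ↥B (↥B ⧸ singIdeal B) 1 (e + 3) ε₀ φ hε₀ hex
  -- the datum at the route's index `syzygyIndex k K - 1 = 1`
  have key : ∀ j : ℕ, j = 1 →
      ∃ (r : ℕ) (ι : ↥(LinearMap.range (d j)) →ₗ[↥B] (Fin r → ↥B))
        (g₀ : Fin r → ↥(LinearMap.range (d j))),
        Function.Injective ι ∧
        (∀ z : Fin r → ↥B, ∃ a : ↥B, a ≠ 0 ∧ a • z ∈ LinearMap.range ι) ∧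
        Matrix.det (Matrix.of fun i j => ((ι (g₀ i) j : ↥B) : K)) ≠ 0 ∧
        (∀ g' : Fin r → ↥(LinearMap.range (d j)),
          Matrix.det (Matrix.of fun i j => ((ι (g' i) j : ↥B) : K)) *
            (Matrix.det (Matrix.of fun i j => ((ι (g₀ i) j : ↥B) : K)))⁻¹ ∈ O) ∧
        (∀ g' : Fin r → ↥(LinearMap.range (d j)),
          Matrix.det (Matrix.of fun i j => ((ι (g' i) j : ↥B) : K)) *
            (Matrix.det (Matrix.of fun i j => ((ι (g₀ i) j : ↥B) : K)))⁻¹ ∈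
            Algebra.adjoin k ((B : Set K) ∪
              {y : K | ∃ a ∈ B, O.valuation a < 1 ∧ y = a * (((xg 0 : ↥B) : K))⁻¹})) ∧
        (∀ i : Fin (e + 2), ∃ g' : Fin r → ↥(LinearMap.range (d j)),
          Matrix.det (Matrix.of fun i j => ((ι (g' i) j : ↥B) : K)) *
            (Matrix.det (Matrix.of fun i j => ((ι (g₀ i) j : ↥B) : K)))⁻¹ =
              (((xg i.succ : ↥B) : K) * (((xg 0 : ↥B) : K))⁻¹) ^ (e + 1)) := by
    rintro j rfl
    exact surfaceStep_datum O B hB hloc xg hspan hminrel hval b d θ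
  obtain ⟨r, ι, g₀, hι, htors, hdet0, hmin, hQ, harrow⟩ := key (syzygyIndex k K - 1) (by omega)
  -- canonical form of the step with this datum
  have hL := locAt_step_eq O O le_rfl B hk hB b d ε r ι g₀ hε h0 hs hι htors hdet0 hmin
  have hfix : locAt O (step O B) = step O B :=
    locAt_locAt O _ (nrm_toSubring_le O hk (chart_toSubring_le O hk hB))
  rw [hfix] at hL
  -- the two charts have the same normalisation
  set Rt := Algebra.adjoin k ((B : Set K) ∪
    {y : K | ∃ g : Fin r → ↥(LinearMap.range (d (syzygyIndex k K - 1))),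
      y = Matrix.det (Matrix.of fun i j => ((ι (g i) j : ↥B) : K)) *
        (Matrix.det (Matrix.of fun i j => ((ι (g₀ i) j : ↥B) : K)))⁻¹}) with hRt
  set Q := Algebra.adjoin k ((B : Set K) ∪
    {y : K | ∃ a ∈ B, O.valuation a < 1 ∧ y = a * (((xg 0 : ↥B) : K))⁻¹}) with hQdef
  have hBRt : B ≤ Rt := fun y hy => Algebra.subset_adjoin (Or.inl hy)
  have hBQ : B ≤ Q := fun y hy => Algebra.subset_adjoin (Or.inl hy)
  have h1 : Rt ≤ Q := by
    refine Algebra.adjoin_le (Set.union_subset (fun y hy => hBQ hy) ?_)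
    rintro y ⟨g, rfl⟩
    exact hQ g
  haveI : IsFractionRing ↥Rt K := isFractionRing_subalgebra_of_le B Rt hBRt
  haveI : IsFractionRing ↥(nrm Rt) K := isFractionRing_subalgebra_of_le B (nrm Rt)
    (hBRt.trans (self_le_nrm Rt))
  haveI : IsIntegrallyClosed ↥(nrm Rt) := isIntegrallyClosed_nrm Rt
  have h2 : Q ≤ nrm Rt := by
    refine Algebra.adjoin_le (Set.union_subset (fun y hy => self_le_nrm Rt (hBRt hy)) ?_)
    rintro y ⟨a, ha, hva, rfl⟩
    -- `a ∈ 𝔪 = (xg)`: `a / xg 0 = ∑ cᵢ · (xg i / xg 0)` with each `xg i / xg 0 ∈ nrm Rt`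
    have ham : (⟨a, ha⟩ : ↥B) ∈ maximalIdeal ↥B :=
      (mem_maximalIdeal_iff_valuation_lt_one O B hB hloc _).mpr hva
    rw [← hspan, Ideal.mem_span_range_iff_exists_fun] at ham
    obtain ⟨c, hc⟩ := ham
    have haK : a = ∑ i, ((c i : ↥B) : K) * ((xg i : ↥B) : K) := by
      have := congrArg B.val hc
      simpa only [map_sum, map_mul, Subalgebra.coe_val] using this.symm
    have hratio : ∀ i : Fin (e + 3), ((xg i : ↥B) : K) * (((xg 0 : ↥B) : K))⁻¹ ∈ nrm Rt := by
      intro i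
      refine Fin.cases ?_ (fun i => ?_) i
      · rw [mul_inv_cancel₀ hx0K]
        exact Subalgebra.one_mem _
      · obtain ⟨g', hg'⟩ := harrow i
        rw [mem_nrm_iff]
        refine IsIntegral.of_pow (Nat.succ_pos e) ?_
        rw [← hg']
        exact isIntegral_of_mem_subalgebra Rt (Algebra.subset_adjoin (Or.inr ⟨g', rfl⟩))
    rw [haK, Finset.sum_mul]
    refine Subalgebra.sum_mem _ fun i _ => ?_
    rw [mul_assoc]
    exact Subalgebra.mul_mem _ (self_le_nrm Rt (hBRt (c i).2)) (hratio i)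
  have hnrm : nrm Rt = nrm Q := by
    apply le_antisymm (nrm_mono h1)
    calc nrm Q ≤ nrm (nrm Rt) := nrm_mono h2
      _ = nrm Rt := nrm_eq_self_of_isIntegrallyClosed (nrm Rt)
  refine ⟨((xg 0 : ↥B) : K), (xg 0).2, hvx0, ?_, ?_⟩
  · intro y hy hvy
    exact valuation_le_of_mem_maximalIdeal O B hB xg hspan hval ⟨y, hy⟩
      ((mem_maximalIdeal_iff_valuation_lt_one O B hB hloc _).mpr hvy)
  · rw [hL, hnrm]


/-! ## Singular surface stages: `singIdeal = 𝔪` and embedding dimension `≥ 3` -/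

/-- A local ring whose localisation at the maximal ideal is regular is regular (the
localisation is the ring itself). [folklore] -/
theorem isRegularLocalRing_of_localization_maximalIdeal (R : Type*) [CommRing R] [IsLocalRing R]
    (h : IsRegularLocalRing (Localization.AtPrime (maximalIdeal R))) : IsRegularLocalRing R := by
  have H : (maximalIdeal R).primeCompl ≤ IsUnit.submonoid R := fun x hx =>
    of_not_not fun hu => hx (mem_nonunits_iff.mpr hu)
  let e : R ≃ₐ[R] Localization.AtPrime (maximalIdeal R) :=
    IsLocalization.atUnits R (maximalIdeal R).primeCompl H
  exact IsRegularLocalRing.of_ringEquiv e.toRingEquiv.symm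

/-- **At a singular ISOLATED stage the non-regular locus is the closed point**:
`singIdeal B = 𝔪`. [folklore] -/
theorem singIdeal_eq_maximalIdeal_of_isolated (B : Subalgebra k K) [IsLocalRing ↥B]
    (hiso : ∀ 𝔭 : PrimeSpectrum ↥B, ¬ 𝔭.asIdeal.IsMaximal →
      IsRegularLocalRing (Localization.AtPrime 𝔭.asIdeal))
    (hsing : ¬ IsRegularLocalRing ↥B) : singIdeal B = maximalIdeal ↥B := by
  have hset : {𝔭 : PrimeSpectrum ↥B | ¬ IsRegularLocalRing (Localization.AtPrime 𝔭.asIdeal)} =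
      {IsLocalRing.closedPoint ↥B} := by
    ext 𝔭
    simp only [Set.mem_setOf_eq, Set.mem_singleton_iff]
    constructor
    · intro h𝔭
      have hmax : 𝔭.asIdeal.IsMaximal := by
        by_contra hm
        exact h𝔭 (hiso 𝔭 hm)
      exact PrimeSpectrum.ext (IsLocalRing.eq_maximalIdeal hmax)
    · rintro rfl
      exact fun h => hsing (isRegularLocalRing_of_localization_maximalIdeal ↥B h)
  unfold singIdeal
  rw [hset, Set.image_singleton, sInf_singleton]
  rfl

/-- **A singular normal Noetherian local domain has embedding dimension `≥ 3`**: dimension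
`≤ 1` would make it regular, so `2 ≤ dim ≤ edim`, and `edim = 2` would make it regular.
[cite: Matsumura1987, Thm. 11.2 and §14 (edim ≥ dim)] -/
theorem exists_spanFinrank_eq_add_three (R : Type*) [CommRing R] [IsDomain R] [IsLocalRing R]
    [IsNoetherianRing R] [IsIntegrallyClosed R] (hsing : ¬ IsRegularLocalRing R) :
    ∃ e : ℕ, (maximalIdeal R).spanFinrank = e + 3 := by
  have h1 : ¬ ringKrullDim R ≤ 1 := fun h =>
    hsing (Literature.AlgebraicGeometry.Resolution.isRegularLocalRing_of_isIntegrallyClosed_of_ringKrullDim_le_one R h)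
  have h2 : (2 : WithBot ℕ∞) ≤ ringKrullDim R :=
    Literature.AlgebraicGeometry.Resolution.WithBot.ENat.two_le_of_not_le_one h1
  have hed : ringKrullDim R ≤ (maximalIdeal R).spanFinrank := ringKrullDim_le_spanFinrank_maximalIdeal R
  have h2e : 2 ≤ (maximalIdeal R).spanFinrank := by
    have : ((2 : ℕ) : WithBot ℕ∞) ≤ ((maximalIdeal R).spanFinrank : WithBot ℕ∞) := h2.trans hed
    exact_mod_cast this
  have hne : (maximalIdeal R).spanFinrank ≠ 2 := by
    intro h
    apply hsing
    refine IsRegularLocalRing.of_spanFinrank_maximalIdeal_le R ?_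
    rw [h]
    exact_mod_cast h2
  exact ⟨(maximalIdeal R).spanFinrank - 3, by omega⟩

/-! ## The registered stub -/

/-- **STUB `stub_surfaceStep` (crux stmt-ResolutionOfSingularities-17044, line `birth`) — at a
singular stage of a surface the step is Zariski's normalised quadratic transform.**  For
`tr.deg_k K = 2` and a SINGULAR stage `T_{m+1}`: there is `x` in the centre of `v` on
`T_{m+1}` of maximal valuation with `T_{m+2} = locAt O (nrm (T_{m+1}[𝔪/x]))`.  The stage is a
normal Noetherian local domain (`stub_stageNormal`), local at the centre (`locAt_tower`),
isolated (`stub_surfaceIsolated`), hence `singIdeal = 𝔪` and `edim ≥ 3`; apply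
`step_eq_quadraticTransform`.  This is the `n = 2` case of "at an isolated
singular stage the norm blow-up of `Ωⁿ(κ)` is the point blow-up up to normalisation"
(Cruxes/RankOneTermination/NOTES.md). [cite: Lipman1978, Theorem p. 151 (the quadratic sequence it governs)] -/
theorem stub_surfaceStep : ∀ (k K : Type) [Field k] [Field K] [Algebra k K]
    (O : ValuationSubring K) (A : Subalgebra k K), (∀ c : k, algebraMap k K c ∈ O) → A.FG →
      IsFractionRing ↥A K → A.toSubring ≤ O.toSubring → syzygyIndex k K = 2 →
      ∀ m : ℕ, ¬ IsRegularLocalRing ↥(tower O A (m + 1)) →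
        ∃ x : K, x ∈ tower O A (m + 1) ∧ O.valuation x < 1 ∧
          (∀ y ∈ tower O A (m + 1), O.valuation y < 1 → O.valuation y ≤ O.valuation x) ∧
          tower O A (m + 2) = locAt O (nrm (Algebra.adjoin k ((tower O A (m + 1) : Set K) ∪
            {y : K | ∃ a ∈ tower O A (m + 1), O.valuation a < 1 ∧ y = a * x⁻¹}))) := by
  intro k K _ _ _ O A hk hFG hFrac hAO hn m hsing
  haveI : IsNoetherianRing ↥(tower O A (m + 1)) := isNoetherianRing_tower O A hk hFG hFrac hAO (m + 1)
  haveI : IsLocalRing ↥(tower O A (m + 1)) := isLocalRing_tower O A hk hAO (m + 1)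
  haveI : IsIntegrallyClosed ↥(tower O A (m + 1)) := stub_stageNormal k K O A hk hFG hFrac hAO m
  have hB : (tower O A (m + 1)).toSubring ≤ O.toSubring := tower_toSubring_le O hk hAO (m + 1)
  have hFracB : IsFractionRing ↥(tower O A (m + 1)) K := isFractionRing_tower O A hFrac (m + 1)
  have hloc : locAt O (tower O A (m + 1)) = tower O A (m + 1) := locAt_tower O A hk hAO (m + 1)
  have hJ : singIdeal (tower O A (m + 1)) = maximalIdeal ↥(tower O A (m + 1)) :=
    singIdeal_eq_maximalIdeal_of_isolated _
      (stub_surfaceIsolated k K O A hk hFG hFrac hAO hn.le (m + 1) (Nat.le_add_left 1 m)) hsing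
  obtain ⟨e, he⟩ := exists_spanFinrank_eq_add_three ↥(tower O A (m + 1)) hsing
  obtain ⟨x, hxB, hvx, hmax, hstep⟩ :=
    step_eq_quadraticTransform O (tower O A (m + 1)) hk hB hFracB hloc hJ hn he
  exact ⟨x, hxB, hvx, hmax, hstep⟩

end Summit.ResolutionOfSingularities.ResolutionOfSingularities.Theorems.SyzygyFlattening

end
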